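import Literature.NumberTheory.GaloisRepresentations.ProfiniteCrossSection
import Mathlib.Topology.Algebra.ContinuousMonoidHom
import Mathlib.Topology.Homeomorph.Lemmas
import HarnessLib

/-!
# Continuous sections of continuous surjections of profinite groups (theorems only)

Corollary of the tree's cross-section theorem `exists_continuous_section_of_isClosed`
(`ProfiniteCrossSection.lean`: Shatz I §2 Thm. 3 / Serre, *Cohomologie galoisienne* I §1.2 Prop. 1,
for the projection `G → G ⧸ N`): a continuous SURJECTIVE homomorphism `q : Ẽ → B` from a profinite
group onto a Hausdorff topological group admits a continuous set-theoretic section `s : C(B, Ẽ)`,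
`q ∘ s = id` (`exists_continuous_section_of_surjective`).  Indeed `Ẽ ⧸ Ker q → B` is a continuous
bijection from a compact space to a Hausdorff space, hence a homeomorphism, and one composes its
inverse with a cross-section of `Ẽ → Ẽ ⧸ Ker q` [cite: SerreGaloisCohomology1997, I §1.2 Prop. 1].

Use (cell abc-iut, L4): supplies the section datum of the central-extension class / transgression
(`Literature/Algebra/Homology/ContCohomologyCentralExtension.lean`, `…Transgression.lean`) for the
cuspidally central extension `1 → I_x → Δ^{c-cn}_{U_x} → Δ_X → 1` of [AbsTopIII] Prop. 1.4 (ii) as a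
THEOREM rather than a model hypothesis (by `liftClass_eq` / `transgression_liftChange` the resulting
class does not depend on the section chosen).  Pointer: abc-iut-L6-t14.
-/

namespace Literature.NumberTheory.GaloisRepresentations

universe u

/-- **A continuous surjective homomorphism from a profinite group onto a Hausdorff group has a
continuous section.** [cite: SerreGaloisCohomology1997, I §1.2 Prop. 1] -/
theorem exists_continuous_section_of_surjective {E B : Type u} [Group E] [TopologicalSpace E]
    [IsTopologicalGroup E] [CompactSpace E] [T2Space E] [TotallyDisconnectedSpace E]
    [Group B] [TopologicalSpace B] [IsTopologicalGroup B] [T2Space B]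
    (q : E →ₜ* B) (hq : Function.Surjective q) :
    ∃ s : C(B, E), ∀ b, q (s b) = b := by
  -- the kernel is a closed normal subgroup
  have hN : IsClosed ((q.toMonoidHom.ker : Subgroup E) : Set E) := by
    have : ((q.toMonoidHom.ker : Subgroup E) : Set E) = q ⁻¹' {1} := by
      ext x
      simp [MonoidHom.mem_ker]
    rw [this]
    exact isClosed_singleton.preimage q.continuous
  obtain ⟨s₀, hs₀, hsec⟩ := exists_continuous_section_of_isClosed q.toMonoidHom.ker hN
  -- `Ẽ ⧸ Ker q ≃ₜ B`
  let f : E ⧸ q.toMonoidHom.ker →* B := QuotientGroup.kerLift q.toMonoidHom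
  have hf_cont : Continuous f :=
    (QuotientGroup.isQuotientMap_mk q.toMonoidHom.ker).continuous_iff.2 q.continuous
  have hf_bij : Function.Bijective f :=
    ⟨QuotientGroup.kerLift_injective q.toMonoidHom, fun b => by
      obtain ⟨e, rfl⟩ := hq b
      exact ⟨QuotientGroup.mk e, rfl⟩⟩
  let ē : E ⧸ q.toMonoidHom.ker ≃ₜ B :=
    Continuous.homeoOfEquivCompactToT2 (f := Equiv.ofBijective f hf_bij) hf_cont
  refine ⟨⟨s₀ ∘ ē.symm, hs₀.comp ē.symm.continuous⟩, fun b => ?_⟩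
  change q (s₀ (ē.symm b)) = b
  have h1 : q (s₀ (ē.symm b)) = f (QuotientGroup.mk (s₀ (ē.symm b))) := rfl
  rw [h1, hsec]
  exact ē.apply_symm_apply b

/-- Variant with the central-extension packaging used by
`ContinuousCohomology.extensionClass`: a continuous section as a `ContinuousMap` together with the
identity `q (s b) = ContinuousMonoidHom.id B b`. [cite: SerreGaloisCohomology1997, I §1.2 Prop. 1] -/
theorem exists_continuous_section_id {E B : Type u} [Group E] [TopologicalSpace E]
    [IsTopologicalGroup E] [CompactSpace E] [T2Space E] [TotallyDisconnectedSpace E]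
    [Group B] [TopologicalSpace B] [IsTopologicalGroup B] [T2Space B]
    (q : E →ₜ* B) (hq : Function.Surjective q) :
    ∃ s : C(B, E), ∀ b, q (s b) = ContinuousMonoidHom.id B b :=
  exists_continuous_section_of_surjective q hq

end Literature.NumberTheory.GaloisRepresentations
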